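import Summits.PneNP.PneNP.Theorems.PhaseTwinsNoFBPPApproxAboveUniquenessCalibration
import Summits.PneNP.PneNP.Theorems.PhaseTwinsAssembly
import Summits.PneNP.PneNP.Theorems.PhaseTwinsHardcoreCountSharpP
import Summits.PneNP.PneNP.Theorems.NPNotSubsetPPoly
import Literature.Computability.Complexity.CircuitClassesUniformProofs
import Literature.Computability.Complexity.NPSubsetBPPCollapse
import Literature.Computability.Complexity.ProbabilisticClassesProofs
import Literature.Computability.Complexity.HardcoreInapproximability
import Literature.Computability.Cryptography.CryptoFoundationsOneWayFunctionsProofs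

/-!
# Crux stmt-PneNP-2717 in the tree's web of registered conjectures (kernel-checked arrows)

`X := Summit.PneNP.PneNP.Theses.PhaseTwins.NoFBPPApproxAboveUniqueness` is a CONJECTURE NODE: lead-0's fact-free
calibration `noFBPPApproxAboveUniqueness_iff_not_NP_subset_BPP` (p93858) pins it exactly at `NP ⊄ BPP`. This file
(line lead prover-line-stmt-PneNP-2717-1, line `Sketch` cycle 1) records, fact-free unless said otherwise, where that
node sits among the conjectures the tree already REGISTERS, so that a planner can re-type X as a conditional bridge:

* `noFBPPApproxAboveUniqueness_iff_NP_ne_RP` — **X ⟺ NP ≠ RP**, FACT-FREE (Ko 1982 `NP ⊆ BPP → NP = RP`, proved in the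
  tree): the Disproof's sandwich `NP ≠ RP ⟹ X ⟹ P ≠ NP` (stated there modulo the GŠV16 named fact) needs no named fact,
  and its lower half is an equivalence;
* `noFBPPApproxAboveUniqueness_of_NPNotSubsetPPoly` — the registered conjecture leaf
  `Summit.PneNP.PneNP.NPNotSubsetPPoly` (`NP ⊄ P/poly`, Cook's circuit form of the summit) implies X (Adleman
  `BPP ⊆ P/poly`, proved);
* `noFBPPApproxAboveUniqueness_of_OWFExist` — the registered conjecture `OWFExist` (one-way functions exist) implies X
  (Goldreich, `NP_not_subset_BPP_of_OWFExist_holds`, proved);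
* `pneNP_of_noFBPPApproxAboveUniqueness` — **X ⟹ PneNP unconditionally** (the route's Assembly and its hypothesis
  `HardcoreCountSharpP` are both proved, so X alone closes route PhaseTwins);
* `noFBPPApproxAboveUniqueness_iff_forall_not_hasFPRAS` — the existential crux equals GŠV16's UNIVERSAL form "no FPRAS
  at ANY admissible `(Δ, p/q)`", CONDITIONAL on the named fact `NP_eq_RP_of_hardcoreFPRAS` (GŠV16 Thm 1, unproved in the
  tree; the fact-free corner needs the whole family of corners, not one instance).
-/

set_option linter.dupNamespace false

namespace Summit.PneNP.PneNP.Theorems.NoFBPPApproxAboveUniqueness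

open Literature.Computability.Complexity Literature.Probability.LatticeModels
open Summit.PneNP.PneNP.Theses.PhaseTwins (NoFBPPApproxAboveUniqueness)

/-- **X ⟺ NP ≠ RP, fact-free.** `⟹`: X gives `NP ⊄ BPP` (calibration), and `NP = RP` would give `NP ⊆ BPP`
(`RP ⊆ BPP`). `⟸`: `NP ⊆ BPP → NP = RP` is Ko's theorem (`NP_eq_RP_of_NP_subset_BPP`, proved in the tree), so
`NP ≠ RP → NP ⊄ BPP → X`. [cite: Ko1982, main theorem] -/
theorem noFBPPApproxAboveUniqueness_iff_NP_ne_RP : NoFBPPApproxAboveUniqueness ↔ Nondeterministic.NP ≠ RP := by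
  rw [noFBPPApproxAboveUniqueness_iff_not_NP_subset_BPP]
  constructor
  · intro h hNPRP
    exact h (hNPRP ▸ RP_subset_BPP_holds)
  · intro h hNP
    exact h (NP_eq_RP_of_NP_subset_BPP hNP)

/-- **`NP ≠ RP → X`, fact-free** (the Disproof's `crux_of_NP_ne_RP` without the GŠV16 hypothesis). [cite: Ko1982, main theorem] -/
theorem noFBPPApproxAboveUniqueness_of_NP_ne_RP (h : Nondeterministic.NP ≠ RP) : NoFBPPApproxAboveUniqueness :=
  noFBPPApproxAboveUniqueness_iff_NP_ne_RP.2 h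

/-- **The registered conjecture `NP ⊄ P/poly` implies X**: `NP ⊆ BPP ⊆ P/poly` (Adleman, `BPP_subset_PPoly_holds`)
would contradict it. [cite: AroraBarakCC2009, Thm. 7.14] -/
theorem noFBPPApproxAboveUniqueness_of_NPNotSubsetPPoly (h : Summit.PneNP.PneNP.NPNotSubsetPPoly) :
    NoFBPPApproxAboveUniqueness :=
  noFBPPApproxAboveUniqueness_of_not_NP_subset_BPP fun hNP => h (hNP.trans BPP_subset_PPoly_holds)

/-- **The registered conjecture "one-way functions exist" implies X** (`OWFExist → NP ⊄ BPP`, Goldreich 2001 §2.1,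
proved in the tree as `NP_not_subset_BPP_of_OWFExist_holds`). [cite: Goldreich2001, §2.7.3 and §1.5.3] -/
theorem noFBPPApproxAboveUniqueness_of_OWFExist (h : Literature.Computability.Cryptography.OWFExist) :
    NoFBPPApproxAboveUniqueness :=
  noFBPPApproxAboveUniqueness_of_not_NP_subset_BPP
    (Literature.Computability.Cryptography.NP_not_subset_BPP_of_OWFExist_holds h)

/-- **X closes the route unconditionally: `X → PneNP`.** The Assembly `HardcoreCountSharpP → X → PneNP`
(`phaseTwins_assembly_proof`, Stockmeyer) and its first hypothesis (`hardcoreCountSharpP_proof`) are proved in the tree.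
[cite: AaronsonArkhipovToC2013, Thm. 4.1 (p. 175)] -/
theorem pneNP_of_noFBPPApproxAboveUniqueness (hX : NoFBPPApproxAboveUniqueness) : _root_.PneNP :=
  phaseTwins_assembly_proof hardcoreCountSharpP_proof hX

/-- **`NP = RP → ¬ PneNP`-free restatement of the sandwich's top: `¬ PneNP → NP = RP`** is NOT claimed; what the tree
gives unconditionally is the chain `OWFExist ∨ NPNotSubsetPPoly ⟹ NP ≠ RP ⟺ NP ⊄ BPP ⟺ X ⟹ PneNP`, assembled here as one
statement for the planner's re-typing. [folklore] -/
theorem conjecture_web :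
    (Literature.Computability.Cryptography.OWFExist ∨ Summit.PneNP.PneNP.NPNotSubsetPPoly → NoFBPPApproxAboveUniqueness) ∧
    (NoFBPPApproxAboveUniqueness ↔ Nondeterministic.NP ≠ RP) ∧
    (NoFBPPApproxAboveUniqueness ↔ ¬ (Nondeterministic.NP ⊆ BPP)) ∧
    (NoFBPPApproxAboveUniqueness → _root_.PneNP) :=
  ⟨fun h => h.elim noFBPPApproxAboveUniqueness_of_OWFExist noFBPPApproxAboveUniqueness_of_NPNotSubsetPPoly,
    noFBPPApproxAboveUniqueness_iff_NP_ne_RP, noFBPPApproxAboveUniqueness_iff_not_NP_subset_BPP,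
    pneNP_of_noFBPPApproxAboveUniqueness⟩

/-- **Existential = universal (conditional on GŠV16 Thm 1).** Modulo the named fact `NP_eq_RP_of_hardcoreFPRAS`
(Galanis–Štefankovič–Vigoda 2016, Thm 1; unproved in the tree) the crux — "SOME admissible `(Δ, p/q)` has no FPRAS" —
is equivalent to "NO admissible `(Δ, p/q)` has an FPRAS": an FPRAS at one admissible instance already gives `NP = RP`,
hence `NP ⊆ BPP`, hence (Theorem N) FPRASes everywhere. CONDITIONAL result (hypothesis `hGSV`).
[cite: GalanisStefankovicVigoda2016, Thm 1] -/
theorem noFBPPApproxAboveUniqueness_iff_forall_not_hasFPRAS (hGSV : NP_eq_RP_of_hardcoreFPRAS) :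
    NoFBPPApproxAboveUniqueness ↔
      ∀ Δ p q : ℕ, 3 ≤ Δ → 0 < q → hardCoreThreshold Δ < (p : ℝ) / q → ¬ HasFPRAS (hardcoreCount Δ p q) := by
  constructor
  · intro hX Δ p q hΔ hq hlam hF
    have hNPRP : Nondeterministic.NP = RP := hGSV Δ p q hΔ hq hlam hF
    exact (noFBPPApproxAboveUniqueness_iff_NP_ne_RP.1 hX) hNPRP
  · intro h
    by_contra hX
    have hall := Negative.not_crux_iff.1 hX
    have hthr : hardCoreThreshold 3 < ((5 : ℕ) : ℝ) / ((1 : ℕ) : ℝ) := by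
      rw [hardCoreThreshold_three]; norm_num
    exact h 3 5 1 le_rfl one_pos hthr (hall 3 5 1 le_rfl one_pos hthr)

end Summit.PneNP.PneNP.Theorems.NoFBPPApproxAboveUniqueness
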